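import Summits.QuantumFields.BalabanUV.Beta.FP.PeriodisedBorderTables

/-!
# `BalabanUV.Beta.FP.PackedVertexPeriodisation` — road «FP» for binder row D1, ROUTE T, memo `N2B-DESIGN.md` (34h) STEP 3, letter (S3-2) «PACKING
# COMMUTES WITH `perF ∘ dper`»: a bond-weighted PACKING of periodised bi-localised vertex kernels IS the periodisation of the packed kernel

WHY.  The level-0 socket (#36b `LevelZeroDoorSocket`) and its adapters (#37 `LevelZeroDoorSocketU23Pure`, #37c `LevelZeroDoorSocketCompanion`) carry the
door's form jets as FUNCTIONS of a direction `v` through table families: `H₁ v = a • Σ_b (hv v b) • TW b + Σ_b (hv v b) • (w • TΛ b)`,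
`H₂ v v′ = a² • Σ_b Σ_b′ (hv v b · hv v′ b′) • TWW b b′`, … where each table IS a periodised bi-localised kernel read on the packed index,
`TW b = (perF M (dper M (𝒯 b))).submatrix e e`.  STEP 3 of the assembly must recognise the PACKED jets `H₁ (d k)`, `½(H₂ (d k)(d l) + H₂ (d l)(d k))`
as `perF M (dper M 𝒱)` of ONE bi-localised kernel each, so that (P2‴) `KernelPeriodisationFibHessKer.hessKer_law_of_torus_hessT_law`'s `hlaw` can be
stated.  THIS FILE is the version-independent half of that recognition: for a finite family of BI-LOCALISED kernels `𝒱 i` and weights `r i`,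
`Σ_i r i • perF M (dper M (𝒱 i)) = perF M (dper M (Σ_i r i • 𝒱 i))` (§1, with the read-out `submatrix` form and an overall weight; §2 the two-index ∕
product-weight form for the order-2 tables and the symmetrised slot; §3 THE SOCKET's JET SHAPES THEMSELVES: the order-1 jet `a • Σ_b x_b • TW b + Σ_b x_b •
(w • TΛ b)` and the order-2 jet `a² • Σ_b Σ_b′ (x_b x′_b′) • TWW b b′` ARE `perF∘dper` of ONE packed kernel), by `PeriodisedBorderTables.dper_finset_sum_smul` +
`perF_finset_sum` + `KernelPeriodisationFibLoc.decays_dper` + `perF_smul`.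
[folklore]; no `def`, no `def … : Prop`, nothing cited, 0 sorry.

HONEST DEPENDENCY (page 1, mandatory): continuum YM on T⁴ ⇐ BetaPertH ∧ nine spine estimates (0/9 proved); BetaPertH ⇐ (D1) ∧ (D4) ∧ CAP+tail;
G-an2-4 gates asym, D1 and NE2/3/4.  HONEST FRAMING (cell contract, verbatim): «discharging `BetaPertH` makes Bałaban's UV stability UNCONDITIONAL —
a real constructive-QFT result; it is NOT the continuum limit and NOT the Clay problem.»  ABSOLUTE RULE (cell charter, verbatim): «No internally-minted
statement may enter as a cited fact. Every hypothesis is either kernel-proved in this package or a verbatim quotation of a PUBLISHED theorem with page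
reference. The manuscript(s) under audit are NOT citable for their own disputed steps — they are the thing under adjudication; programme-internal
(2001/route/tribunal) claims are never citable.»  Finite sums of absolutely convergent period sums; nothing of Bałaban's asserted; 0 estimates beyond the
cited decay book-keeping; 0∕4 row-D1 binders (hW, hR, D1Tel, D1Rep); NOT (T-ID), NOT SDF, NOT D1, NOT BetaPertH, NOT continuum, NOT Clay.  Road «FP»
OWNER, b2b-balaban-beta-d1-p3 gen 25, 2026-08-23.  No existing file touched.
-/

noncomputable section

open scoped BigOperators Matrix

namespace Summit.QuantumFields.BalabanUV.Beta.FP.PackedVertexPeriodisation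

open Literature.MathematicalPhysics.QuantumFieldTheory.Balaban1983to89
open Literature.MathematicalPhysics.QuantumFieldTheory.Balaban1983to89.Beta
open ExpKernelCalculus (MKer Decays BiLoc)
open AffineAveraging (Site)
open Summit.QuantumFields.BalabanUV.Beta.FP.KernelPeriodisationFib (perF perF_smul Idx)
open Summit.QuantumFields.BalabanUV.Beta.FP.KernelPeriodisationFibLoc (dper decays_dper)
open Summit.QuantumFields.BalabanUV.Beta.FP.PeriodisedBorderTables (dper_finset_sum_smul perF_finset_sum)

variable {d : ℕ} {F : Type*} (M : Fin (d + 1) → ℕ) [∀ μ, NeZero (M μ)] {ι ι' ν : Type*}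

/-! ## §1 Packing commutes with `perF ∘ dper` -/

/-- [folklore] a scalar multiple of a decaying kernel decays (constant `|c|·C`). -/
theorem decays_smul {K : MKer (d + 1) F} {C δ : ℝ} (hK : Decays K C δ) (c : ℝ) : Decays (c • K) (|c| * C) δ := fun x y a b => by
  rw [Pi.smul_apply, Pi.smul_apply, Pi.smul_apply, Pi.smul_apply, smul_eq_mul, abs_mul, mul_assoc]
  exact mul_le_mul_of_nonneg_left (hK x y a b) (abs_nonneg _)

/-- [folklore] each weighted periodised bi-localised summand decays (the hypothesis `perF_finset_sum` wants). -/
theorem decays_smul_dper_of_biLoc (s : Finset ι) (r : ι → ℝ) (𝒱 : ι → MKer (d + 1) F)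
    (hV : ∀ i ∈ s, ∃ (p q : Site (d + 1)) (C δ : ℝ), 0 ≤ C ∧ 0 < δ ∧ BiLoc (𝒱 i) p q C δ) :
    ∀ i ∈ s, ∃ C δ : ℝ, 0 < δ ∧ Decays (r i • dper M (𝒱 i)) C δ := fun i hi => by
  obtain ⟨p, q, C, δ, hC, hδ, h⟩ := hV i hi
  exact ⟨_, δ / 2, half_pos hδ, decays_smul (decays_dper M h hC hδ) (r i)⟩

/-- [folklore] **PACKING COMMUTES WITH `perF ∘ dper`**: for bi-localised `𝒱 i`, `Σ_{i ∈ s} r i • perF M (dper M (𝒱 i)) = perF M (dper M (Σ_{i ∈ s} r i • 𝒱 i))`. -/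
theorem sum_smul_perF_dper (s : Finset ι) (r : ι → ℝ) (𝒱 : ι → MKer (d + 1) F)
    (hV : ∀ i ∈ s, ∃ (p q : Site (d + 1)) (C δ : ℝ), 0 ≤ C ∧ 0 < δ ∧ BiLoc (𝒱 i) p q C δ) :
    ∑ i ∈ s, r i • perF M (dper M (𝒱 i)) = perF M (dper M (∑ i ∈ s, r i • 𝒱 i)) := by
  rw [dper_finset_sum_smul M s r 𝒱 hV, perF_finset_sum M s _ (decays_smul_dper_of_biLoc M s r 𝒱 hV)]
  exact Finset.sum_congr rfl fun i _ => (perF_smul M (r i) (dper M (𝒱 i))).symm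

/-- [folklore] the READ-OUT form on any index embedding `e, e′` (the socket's tables are `submatrix` read-outs of `perF ∘ dper`):
`Σ_i r i • (perF M (dper M (𝒱 i))).submatrix e e′ = (perF M (dper M (Σ_i r i • 𝒱 i))).submatrix e e′`. -/
theorem sum_smul_perF_dper_submatrix (s : Finset ι) (r : ι → ℝ) (𝒱 : ι → MKer (d + 1) F)
    (hV : ∀ i ∈ s, ∃ (p q : Site (d + 1)) (C δ : ℝ), 0 ≤ C ∧ 0 < δ ∧ BiLoc (𝒱 i) p q C δ)
    (e : ν → Idx M F) (e' : ι' → Idx M F) :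
    ∑ i ∈ s, r i • (perF M (dper M (𝒱 i))).submatrix e e' = (perF M (dper M (∑ i ∈ s, r i • 𝒱 i))).submatrix e e' := by
  rw [← sum_smul_perF_dper M s r 𝒱 hV]
  ext a b
  simp only [Matrix.submatrix_apply, Matrix.sum_apply, Matrix.smul_apply]

/-- [folklore] an extra overall weight (the socket's `a •`, `w •`): `a • Σ_i r i • perF M (dper M (𝒱 i)) = perF M (dper M (Σ_i (a * r i) • 𝒱 i))`. -/
theorem smul_sum_smul_perF_dper (a : ℝ) (s : Finset ι) (r : ι → ℝ) (𝒱 : ι → MKer (d + 1) F)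
    (hV : ∀ i ∈ s, ∃ (p q : Site (d + 1)) (C δ : ℝ), 0 ≤ C ∧ 0 < δ ∧ BiLoc (𝒱 i) p q C δ) :
    a • ∑ i ∈ s, r i • perF M (dper M (𝒱 i)) = perF M (dper M (∑ i ∈ s, (a * r i) • 𝒱 i)) := by
  rw [← sum_smul_perF_dper M s (fun i => a * r i) 𝒱 hV, Finset.smul_sum]
  exact Finset.sum_congr rfl fun i _ => smul_smul a (r i) _

/-! ## §2 The order-2 tables: product weights over a pair of finite families -/

/-- [folklore] **the bilinear packing**: for a bi-localised two-index family `𝒲 i j`,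
`Σ_i Σ_j (r i * r′ j) • perF M (dper M (𝒲 i j)) = perF M (dper M (Σ_i Σ_j (r i * r′ j) • 𝒲 i j))`. -/
theorem sum_sum_smul_perF_dper (s : Finset ι) (t : Finset ι') (r : ι → ℝ) (r' : ι' → ℝ) (𝒲 : ι → ι' → MKer (d + 1) F)
    (hW : ∀ i ∈ s, ∀ j ∈ t, ∃ (p q : Site (d + 1)) (C δ : ℝ), 0 ≤ C ∧ 0 < δ ∧ BiLoc (𝒲 i j) p q C δ) :
    ∑ i ∈ s, ∑ j ∈ t, (r i * r' j) • perF M (dper M (𝒲 i j)) = perF M (dper M (∑ i ∈ s, ∑ j ∈ t, (r i * r' j) • 𝒲 i j)) := by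
  -- one application of §1 over the product family `(i, j) ↦ 𝒲 i j` with the product weights
  have h := sum_smul_perF_dper M (s ×ˢ t) (fun p => r p.1 * r' p.2) (fun p => 𝒲 p.1 p.2) fun p hp => by
    obtain ⟨hi, hj⟩ := Finset.mem_product.1 hp
    exact hW p.1 hi p.2 hj
  simpa only [Finset.sum_product] using h

/-- [folklore] the read-out form of §2 on any index embedding. -/
theorem sum_sum_smul_perF_dper_submatrix (s : Finset ι) (t : Finset ι') (r : ι → ℝ) (r' : ι' → ℝ) (𝒲 : ι → ι' → MKer (d + 1) F)
    (hW : ∀ i ∈ s, ∀ j ∈ t, ∃ (p q : Site (d + 1)) (C δ : ℝ), 0 ≤ C ∧ 0 < δ ∧ BiLoc (𝒲 i j) p q C δ)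
    {ν' ν'' : Type*} (e : ν' → Idx M F) (e' : ν'' → Idx M F) :
    ∑ i ∈ s, ∑ j ∈ t, (r i * r' j) • (perF M (dper M (𝒲 i j))).submatrix e e'
      = (perF M (dper M (∑ i ∈ s, ∑ j ∈ t, (r i * r' j) • 𝒲 i j))).submatrix e e' := by
  rw [← sum_sum_smul_perF_dper M s t r r' 𝒲 hW]
  ext a b
  simp only [Matrix.submatrix_apply, Matrix.sum_apply, Matrix.smul_apply]

/-- [folklore] **the SYMMETRISED order-2 slot** (the socket's `½ • (W kl + W lk)`): for bi-localised `W₁ W₂`,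
`½ • (perF M (dper M W₁) + perF M (dper M W₂)) = perF M (dper M (½ • (W₁ + W₂)))`. -/
theorem half_add_perF_dper {W₁ W₂ : MKer (d + 1) F}
    (h₁ : ∃ (p q : Site (d + 1)) (C δ : ℝ), 0 ≤ C ∧ 0 < δ ∧ BiLoc W₁ p q C δ) (h₂ : ∃ (p q : Site (d + 1)) (C δ : ℝ), 0 ≤ C ∧ 0 < δ ∧ BiLoc W₂ p q C δ) :
    (1 / 2 : ℝ) • (perF M (dper M W₁) + perF M (dper M W₂)) = perF M (dper M ((1 / 2 : ℝ) • (W₁ + W₂))) := by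
  have h := sum_smul_perF_dper M (Finset.univ : Finset (Fin 2)) (fun _ => (1 / 2 : ℝ)) ![W₁, W₂] fun i _ => by
    fin_cases i
    · exact h₁
    · exact h₂
  simp only [Fin.sum_univ_two, Matrix.cons_val_zero, Matrix.cons_val_one] at h
  rw [smul_add, smul_add]
  exact h

/-! ## §3 The socket's jet SHAPES pack: the order-1 form jet (two table families, an overall weight on the first) and the order-2 form jet -/

/-- [folklore] **the ORDER-1 form jet packs** (#36b's `hH₁ : H₁ v = a • Σ_b (hv v b) • TW b + Σ_b (hv v b) • (w • TΛ b)` with `perF∘dper` tables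
read on an embedding `e`): `a • Σ_b x b • (perF M (dper M (𝒜 b))).submatrix e e + Σ_b x b • (w • (perF M (dper M (ℒ b))).submatrix e e)
= (perF M (dper M (Σ_b (a * x b) • 𝒜 b + Σ_b (w * x b) • ℒ b))).submatrix e e` — ONE application of §1 over the index `ι ⊕ ι`. -/
theorem orderOne_jet_perF_dper [Fintype ι] (a w : ℝ) (x : ι → ℝ) (𝒜 ℒ : ι → MKer (d + 1) F)
    (h𝒜 : ∀ b, ∃ (p q : Site (d + 1)) (C δ : ℝ), 0 ≤ C ∧ 0 < δ ∧ BiLoc (𝒜 b) p q C δ)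
    (hℒ : ∀ b, ∃ (p q : Site (d + 1)) (C δ : ℝ), 0 ≤ C ∧ 0 < δ ∧ BiLoc (ℒ b) p q C δ) (e : ν → Idx M F) :
    a • (∑ b, x b • (perF M (dper M (𝒜 b))).submatrix e e) + ∑ b, x b • (w • (perF M (dper M (ℒ b))).submatrix e e)
      = (perF M (dper M (∑ b, (a * x b) • 𝒜 b + ∑ b, (w * x b) • ℒ b))).submatrix e e := by
  have h := sum_smul_perF_dper M (Finset.univ : Finset (ι ⊕ ι)) (Sum.elim (fun b => a * x b) (fun b => w * x b)) (Sum.elim 𝒜 ℒ)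
    fun i _ => by
      cases i with
      | inl b => exact h𝒜 b
      | inr b => exact hℒ b
  simp only [Fintype.sum_sum_type, Sum.elim_inl, Sum.elim_inr] at h
  rw [← h]
  ext p q
  simp only [Matrix.add_apply, Matrix.smul_apply, Matrix.sum_apply, Matrix.submatrix_apply, smul_eq_mul, Finset.mul_sum]
  congr 1
  · exact Finset.sum_congr rfl fun b _ => by ring
  · exact Finset.sum_congr rfl fun b _ => by ring

/-- [folklore] **the ORDER-2 form jet packs** (#36b's `hH₂ : H₂ v v′ = a ^ 2 • Σ_b Σ_b′ (hv v b * hv v′ b′) • TWW b b′`):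
`a ^ 2 • Σ_b Σ_b′ (x b * x′ b′) • (perF M (dper M (𝒲 b b′))).submatrix e e = (perF M (dper M (Σ_b Σ_b′ (a ^ 2 * (x b * x′ b′)) • 𝒲 b b′))).submatrix e e`. -/
theorem orderTwo_jet_perF_dper [Fintype ι] [Fintype ι'] (a : ℝ) (x : ι → ℝ) (x' : ι' → ℝ) (𝒲 : ι → ι' → MKer (d + 1) F)
    (hW : ∀ b b', ∃ (p q : Site (d + 1)) (C δ : ℝ), 0 ≤ C ∧ 0 < δ ∧ BiLoc (𝒲 b b') p q C δ) (e : ν → Idx M F) :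
    a ^ 2 • ∑ b, ∑ b', (x b * x' b') • (perF M (dper M (𝒲 b b'))).submatrix e e
      = (perF M (dper M (∑ b, ∑ b', (a ^ 2 * (x b * x' b')) • 𝒲 b b'))).submatrix e e := by
  have h := sum_smul_perF_dper_submatrix M ((Finset.univ : Finset ι) ×ˢ (Finset.univ : Finset ι'))
    (fun p : ι × ι' => a ^ 2 * (x p.1 * x' p.2)) (fun p => 𝒲 p.1 p.2) (fun p _ => hW p.1 p.2) e e
  simp only [Finset.sum_product] at h
  rw [← h, Finset.smul_sum]
  refine Finset.sum_congr rfl fun b _ => ?_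
  rw [Finset.smul_sum]
  exact Finset.sum_congr rfl fun b' _ => smul_smul _ _ _

end Summit.QuantumFields.BalabanUV.Beta.FP.PackedVertexPeriodisation

end
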